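import Summits.PneNP.PneNP.Theorems.ConvexRankGatesConvexGateBlindExactLiftingOneSided

/-!
# `ExactLifting`: an arbitrary positive ANCHOR cannot rescue a one-sided junta factorisation

Support file for crux `ConvexGateBlind` (stmt-PneNP-10680), line `xor-door-perfect-completeness`, open stub
`stub_exactLifting` (prover seat 0, session 18).

By `exactLifting_iff_anchored` (`…ExactLiftingAnchored.lean`) the open stub is a lower bound on ANCHORED cone
factorisations of the unshifted Index-lift: `viol_F(x[w]) = tr(H_x Y_w) + ∑_l U_{x,l} V_{l,w} + a(x) b(w)` with ONE
entrywise-positive rank-one term `a ⊗ b` (the anchor) of arbitrary shape. The landed obstructions to junta-type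
factorisations all concern the ISOTROPIC anchor `ε ⊗ 𝟙` (a positive SHIFT): `no_blockJunta_shift_of`,
`no_oneSidedJunta_shift_of` and its corollaries (`…ExactLiftingBlockJunta.lean`, `…ExactLiftingOneSided.lean`). Their
mechanism — restrict to the XOR core, average over the core translations `z`, apply `Ẽ` — does not survive a
general anchor: after averaging, the anchor becomes the cross-correlation `(α ⋆ β)(y')` of two arbitrary positive
functions on `𝔽₂^m`, whose pseudo-expectation can be NEGATIVE (e.g. `α` close to `δ_0`, `β = viol_F − 1/2`), so no
contradiction arises for MIXED-side junta terms.

This file shows that for ONE-SIDED junta terms the anchor is nevertheless powerless, whatever its shape: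

* `no_colJuntaTerms_anchor_of` — no identity `viol_F(x[w]) = ∑_l T_l(x,w) + a(x) b(w)` with `T_l ≥ 0`, every
  `T_l(x, ·)` a block-`d`-junta of the pointer `w`, and `a, b > 0` pointwise (any number of terms, any `t ≥ 2`);
* `no_rowJuntaTerms_anchor_of` — the same with every `T_l(·, w)` a block-`d`-junta of the table `x`;
* rank-one corollaries `no_colJunta_anchor_of`, `no_rowJunta_anchor_of`, and cone corollaries
  `no_colJunta_anchoredConeFact_of` (PSD column factor `Y_w` and LP column factors `V_{l,·}` juntas; `H`, `U`, anchor
  arbitrary) and `no_rowJunta_anchoredConeFact_of` (PSD row factor `H_x` and LP row factors `U_{·,l}` juntas).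

Mechanism (new ingredient: a second averaging that makes the anchor CONSTANT). Column case: on the core row `X z`
read along `y ↦ W(z + y)` the identity becomes `viol_F(y) = ∑_l T_l(X z, W(z+y)) + a(X z) · b(W(z+y))`; every
`T_l`-term is a non-negative `d`-junta of `y`, so applying `Ẽ` (with `Ẽ[viol_F] = 0`) and dividing by `a(X z) > 0`
gives `Ẽ_y[b(W(z+y))] ≤ 0` for EVERY `z`; but `∑_z b(W(z+y)) = ∑_z b(W z) =: B > 0` does not depend on `y`, so
summing over `z` gives `B = Ẽ[B] ≤ 0`, absurd. Row case: dually, on the core column `W y` read along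
`s ↦ X(y + s)`, `Ẽ_s[a(X(y+s))] ≤ 0` for every `y` while `∑_y a(X(y+s)) = ∑_z a(X z) > 0`. Only the Sherali–Adams
clause of the pseudo-expectation, `Ẽ[1] = 1` and `Ẽ[viol_F] = 0` are used; everything is size-free.

Consequence for the stub: in an anchored factorisation of `lift_t(viol_F)` that `AnchoredLifting` claims must be large,
the non-anchor terms cannot all be column-juntas, nor all be row-juntas, for ANY anchor — the cheap junta dictionary
`1[w_S = π]` of the unshifted lift cannot be completed by a single positive rank-one term of any shape. Together with
`no_oneSidedJunta_shift_of` this leaves exactly one junta-type format unexcluded: mixed sides WITH a non-isotropic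
anchor (see the session memo for why the XOR core alone cannot exclude it).
-/

set_option linter.dupNamespace false -- `Summit.PneNP.PneNP.…`: summit = sub-problem (D-0017)

namespace Summit.PneNP.PneNP.Theorems.XorDoor

open scoped BigOperators
open Finset Matrix

noncomputable section

/-! ## §1 Column-junta terms plus an arbitrary positive anchor -/

/-- **No column-junta decomposition with a positive anchor.** Let `F` carry a degree-`d` perfect-completeness
pseudo-expectation and `t ≥ 2`. There is no identity `viol_F(x[w]) = ∑_l T_l(x, w) + a(x) b(w)` with finitely many
NON-NEGATIVE terms `T_l`, each a block-junta in the pointer `w` for every fixed table `x` (it depends only on `w i`,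
`i ∈ S l`, `#(S l) ≤ d`), and an entrywise POSITIVE rank-one anchor `a ⊗ b` of arbitrary shape — regardless of the
number of terms. -/
theorem no_colJuntaTerms_anchor_of {m d t : ℕ} {F : Finset (Pool m)} (hE : HasPerfectPseudoExp d F)
    (ht : 2 ≤ t) {L : Type} [Fintype L] (S : L → Finset (Fin m)) (hS : ∀ l, (S l).card ≤ d)
    (T : L → (Fin m → Fin t → ZMod 2) → (Fin m → Fin t) → ℝ)
    (hT0 : ∀ l x w, 0 ≤ T l x w)
    (hT : ∀ l (x : Fin m → Fin t → ZMod 2) (w w' : Fin m → Fin t),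
      (∀ i ∈ S l, w i = w' i) → T l x w = T l x w')
    (a : (Fin m → Fin t → ZMod 2) → ℝ) (b : (Fin m → Fin t) → ℝ)
    (ha : ∀ x, 0 < a x) (hb : ∀ w, 0 < b w) :
    ¬ ∀ (x : Fin m → Fin t → ZMod 2) (w : Fin m → Fin t),
        (viol F (fun i => x i (w i)) : ℝ) = ∑ l, T l x w + a x * b w := by
  classical
  intro hfact
  obtain ⟨E, hSA, -, hone, hviol⟩ := hE
  -- the XOR core: tables `X z`, pointers `W y`, `(X z)[W y] = z + y`
  obtain ⟨X, W, hread, -, hWc⟩ := exists_xorCore ht m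
  have hccl : ∀ z y : Fin m → ZMod 2, z + (z + y) = y := fun z y => by
    funext i
    simp only [Pi.add_apply]
    rw [← add_assoc, CharTwo.add_self_eq_zero, zero_add]
  -- Step 1: on every core row, the pseudo-expectation of the (re-read) anchor column factor is `≤ 0`.
  have hkey : ∀ z : Fin m → ZMod 2, E (fun y => b (W (z + y))) ≤ 0 := by
    intro z
    have hrow : (fun y => (viol F y : ℝ)) =
        ∑ l, (fun y => T l (X z) (W (z + y))) + a (X z) • fun y => b (W (z + y)) := by
      funext y
      have h := hfact (X z) (W (z + y))
      rw [show (fun i => X z i (W (z + y) i)) = y from by rw [hread z (z + y), hccl]] at h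
      simp only [Pi.add_apply, Finset.sum_apply, Pi.smul_apply, smul_eq_mul]
      exact h
    have hjunta : ∀ l, IsJunta d (fun y => T l (X z) (W (z + y))) := fun l =>
      ⟨S l, hS l, fun y y' hyy' => hT l (X z) _ _ fun i hi =>
        hWc _ _ i (by simp only [Pi.add_apply, hyy' i hi])⟩
    have hsum : 0 ≤ ∑ l, E (fun y => T l (X z) (W (z + y))) :=
      Finset.sum_nonneg fun l _ => hSA _ (hjunta l) fun y => hT0 l _ _
    have hEq := congrArg E hrow
    rw [hviol, map_add, map_sum, map_smul, smul_eq_mul] at hEq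
    have hprod : a (X z) * E (fun y => b (W (z + y))) ≤ a (X z) * 0 := by
      rw [mul_zero]
      linarith
    exact le_of_mul_le_mul_left hprod (ha (X z))
  -- Step 2: summed over `z`, the re-read anchor factors are a positive CONSTANT function of `y`.
  have hB : ∀ y : Fin m → ZMod 2,
      ∑ z : Fin m → ZMod 2, b (W (z + y)) = ∑ z : Fin m → ZMod 2, b (W z) := fun y =>
    Fintype.sum_equiv (Equiv.addRight y) _ _ fun z => rfl
  have hBpos : 0 < ∑ z : Fin m → ZMod 2, b (W z) :=
    Finset.sum_pos (fun z _ => hb (W z)) Finset.univ_nonempty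
  have hfun : ∑ z : Fin m → ZMod 2, (fun y => b (W (z + y)))
      = (∑ z : Fin m → ZMod 2, b (W z)) • fun _ => (1 : ℝ) := by
    funext y
    simp only [Finset.sum_apply, Pi.smul_apply, smul_eq_mul, mul_one]
    exact hB y
  have h1 : E (∑ z : Fin m → ZMod 2, (fun y => b (W (z + y)))) = ∑ z : Fin m → ZMod 2, b (W z) := by
    rw [hfun, map_smul, hone, smul_eq_mul, mul_one]
  have h2 : E (∑ z : Fin m → ZMod 2, (fun y => b (W (z + y)))) ≤ 0 := by
    rw [map_sum]
    exact Finset.sum_nonpos fun z _ => hkey z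
  linarith

/-- **No column-junta decomposition with a positive anchor** — registered sub-goal `no_colJuntaTerms_anchor` of
stmt-PneNP-10680, verbatim signature (see `no_colJuntaTerms_anchor_of`). -/
theorem no_colJuntaTerms_anchor :
    ∀ {m d t : ℕ} {F : Finset (Pool m)}, HasPerfectPseudoExp d F → 2 ≤ t → ∀ {L : Type} [Fintype L] (S : L →
    Finset (Fin m)), (∀ l, (S l).card ≤ d) → ∀ (T : L → (Fin m → Fin t → ZMod 2) → (Fin m → Fin t) → ℝ), (∀ l x
    w, 0 ≤ T l x w) → (∀ l (x : Fin m → Fin t → ZMod 2) (w w' : Fin m → Fin t), (∀ i ∈ S l, w i = w' i) → T l x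
    w = T l x w') → ∀ (a : (Fin m → Fin t → ZMod 2) → ℝ) (b : (Fin m → Fin t) → ℝ), (∀ x, 0 < a x) → (∀ w, 0 <
    b w) → ¬ ∀ (x : Fin m → Fin t → ZMod 2) (w : Fin m → Fin t), (viol F (fun i => x i (w i)) : ℝ) = ∑ l, T l x
    w + a x * b w :=
  fun hE ht _ _ S hS T hT0 hT a b ha hb => no_colJuntaTerms_anchor_of hE ht S hS T hT0 hT a b ha hb

/-! ## §2 Row-junta terms plus an arbitrary positive anchor -/

/-- **No row-junta decomposition with a positive anchor.** Let `F` carry a degree-`d` perfect-completeness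
pseudo-expectation and `t ≥ 2`. There is no identity `viol_F(x[w]) = ∑_l T_l(x, w) + a(x) b(w)` with finitely many
NON-NEGATIVE terms `T_l`, each a block-junta in the table `x` for every fixed pointer `w` (it depends only on the
blocks `x i`, `i ∈ S l`, `#(S l) ≤ d`), and an entrywise POSITIVE rank-one anchor `a ⊗ b` of arbitrary shape. -/
theorem no_rowJuntaTerms_anchor_of {m d t : ℕ} {F : Finset (Pool m)} (hE : HasPerfectPseudoExp d F)
    (ht : 2 ≤ t) {L : Type} [Fintype L] (S : L → Finset (Fin m)) (hS : ∀ l, (S l).card ≤ d)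
    (T : L → (Fin m → Fin t → ZMod 2) → (Fin m → Fin t) → ℝ)
    (hT0 : ∀ l x w, 0 ≤ T l x w)
    (hT : ∀ l (w : Fin m → Fin t) (x x' : Fin m → Fin t → ZMod 2),
      (∀ i ∈ S l, x i = x' i) → T l x w = T l x' w)
    (a : (Fin m → Fin t → ZMod 2) → ℝ) (b : (Fin m → Fin t) → ℝ)
    (ha : ∀ x, 0 < a x) (hb : ∀ w, 0 < b w) :
    ¬ ∀ (x : Fin m → Fin t → ZMod 2) (w : Fin m → Fin t),
        (viol F (fun i => x i (w i)) : ℝ) = ∑ l, T l x w + a x * b w := by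
  classical
  intro hfact
  obtain ⟨E, hSA, -, hone, hviol⟩ := hE
  obtain ⟨X, W, hread, hXc, -⟩ := exists_xorCore ht m
  have hccm : ∀ y s : Fin m → ZMod 2, y + s + y = s := fun y s => by
    funext i
    simp only [Pi.add_apply]
    rw [add_comm (y i) (s i), add_assoc, CharTwo.add_self_eq_zero, add_zero]
  -- Step 1: on every core column, the pseudo-expectation of the (re-read) anchor row factor is `≤ 0`.
  have hkey : ∀ y : Fin m → ZMod 2, E (fun s => a (X (y + s))) ≤ 0 := by
    intro y
    have hcol : (fun s => (viol F s : ℝ)) =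
        ∑ l, (fun s => T l (X (y + s)) (W y)) + b (W y) • fun s => a (X (y + s)) := by
      funext s
      have h := hfact (X (y + s)) (W y)
      rw [show (fun i => X (y + s) i (W y i)) = s from by rw [hread (y + s) y, hccm]] at h
      simp only [Pi.add_apply, Finset.sum_apply, Pi.smul_apply, smul_eq_mul]
      rw [h, mul_comm (a (X (y + s))) (b (W y))]
    have hjunta : ∀ l, IsJunta d (fun s => T l (X (y + s)) (W y)) := fun l =>
      ⟨S l, hS l, fun s s' hss' => hT l (W y) _ _ fun i hi =>
        hXc _ _ i (by simp only [Pi.add_apply, hss' i hi])⟩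
    have hsum : 0 ≤ ∑ l, E (fun s => T l (X (y + s)) (W y)) :=
      Finset.sum_nonneg fun l _ => hSA _ (hjunta l) fun s => hT0 l _ _
    have hEq := congrArg E hcol
    rw [hviol, map_add, map_sum, map_smul, smul_eq_mul] at hEq
    have hprod : b (W y) * E (fun s => a (X (y + s))) ≤ b (W y) * 0 := by
      rw [mul_zero]
      linarith
    exact le_of_mul_le_mul_left hprod (hb (W y))
  -- Step 2: summed over `y`, the re-read anchor factors are a positive CONSTANT function of `s`.
  have hA : ∀ s : Fin m → ZMod 2,
      ∑ y : Fin m → ZMod 2, a (X (y + s)) = ∑ z : Fin m → ZMod 2, a (X z) := fun s =>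
    Fintype.sum_equiv (Equiv.addRight s) _ _ fun y => rfl
  have hApos : 0 < ∑ z : Fin m → ZMod 2, a (X z) :=
    Finset.sum_pos (fun z _ => ha (X z)) Finset.univ_nonempty
  have hfun : ∑ y : Fin m → ZMod 2, (fun s => a (X (y + s)))
      = (∑ z : Fin m → ZMod 2, a (X z)) • fun _ => (1 : ℝ) := by
    funext s
    simp only [Finset.sum_apply, Pi.smul_apply, smul_eq_mul, mul_one]
    exact hA s
  have h1 : E (∑ y : Fin m → ZMod 2, (fun s => a (X (y + s)))) = ∑ z : Fin m → ZMod 2, a (X z) := by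
    rw [hfun, map_smul, hone, smul_eq_mul, mul_one]
  have h2 : E (∑ y : Fin m → ZMod 2, (fun s => a (X (y + s)))) ≤ 0 := by
    rw [map_sum]
    exact Finset.sum_nonpos fun y _ => hkey y
  linarith

/-- **No row-junta decomposition with a positive anchor** — registered sub-goal `no_rowJuntaTerms_anchor` of
stmt-PneNP-10680, verbatim signature (see `no_rowJuntaTerms_anchor_of`). -/
theorem no_rowJuntaTerms_anchor :
    ∀ {m d t : ℕ} {F : Finset (Pool m)}, HasPerfectPseudoExp d F → 2 ≤ t → ∀ {L : Type} [Fintype L] (S : L →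
    Finset (Fin m)), (∀ l, (S l).card ≤ d) → ∀ (T : L → (Fin m → Fin t → ZMod 2) → (Fin m → Fin t) → ℝ), (∀ l x
    w, 0 ≤ T l x w) → (∀ l (w : Fin m → Fin t) (x x' : Fin m → Fin t → ZMod 2), (∀ i ∈ S l, x i = x' i) → T l x
    w = T l x' w) → ∀ (a : (Fin m → Fin t → ZMod 2) → ℝ) (b : (Fin m → Fin t) → ℝ), (∀ x, 0 < a x) → (∀ w, 0 <
    b w) → ¬ ∀ (x : Fin m → Fin t → ZMod 2) (w : Fin m → Fin t), (viol F (fun i => x i (w i)) : ℝ) = ∑ l, T l x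
    w + a x * b w :=
  fun hE ht _ _ S hS T hT0 hT a b ha hb => no_rowJuntaTerms_anchor_of hE ht S hS T hT0 hT a b ha hb

/-! ## §3 Rank-one corollaries -/

/-- **Column-junta factors plus an anchor are impossible** (row factors arbitrary): no identity
`viol_F(x[w]) = ∑_l u_l(x) v_l(w) + a(x) b(w)` with `u_l, v_l ≥ 0`, every `v_l` depending only on `w i`, `i ∈ S l`
(`#(S l) ≤ d`), and `a, b > 0`. In particular the column dictionary `1[w_S = π]` of the cheap `#F · t³`
factorisation of the unshifted lift admits NO completion by one positive rank-one term. -/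
theorem no_colJunta_anchor_of {m d t : ℕ} {F : Finset (Pool m)} (hE : HasPerfectPseudoExp d F)
    (ht : 2 ≤ t) {L : Type} [Fintype L] (S : L → Finset (Fin m)) (hS : ∀ l, (S l).card ≤ d)
    (u : L → (Fin m → Fin t → ZMod 2) → ℝ) (v : L → (Fin m → Fin t) → ℝ)
    (hu0 : ∀ l x, 0 ≤ u l x) (hv0 : ∀ l w, 0 ≤ v l w)
    (hv : ∀ l (w w' : Fin m → Fin t), (∀ i ∈ S l, w i = w' i) → v l w = v l w')
    (a : (Fin m → Fin t → ZMod 2) → ℝ) (b : (Fin m → Fin t) → ℝ)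
    (ha : ∀ x, 0 < a x) (hb : ∀ w, 0 < b w) :
    ¬ ∀ (x : Fin m → Fin t → ZMod 2) (w : Fin m → Fin t),
        (viol F (fun i => x i (w i)) : ℝ) = ∑ l, u l x * v l w + a x * b w :=
  no_colJuntaTerms_anchor_of hE ht S hS (fun l x w => u l x * v l w)
    (fun l x w => mul_nonneg (hu0 l x) (hv0 l w)) (fun l x w w' h => by rw [hv l w w' h]) a b ha hb

/-- **Row-junta factors plus an anchor are impossible** (column factors arbitrary): no identity
`viol_F(x[w]) = ∑_l u_l(x) v_l(w) + a(x) b(w)` with `u_l, v_l ≥ 0`, every `u_l` depending only on the blocks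
`x i`, `i ∈ S l` (`#(S l) ≤ d`), and `a, b > 0`. -/
theorem no_rowJunta_anchor_of {m d t : ℕ} {F : Finset (Pool m)} (hE : HasPerfectPseudoExp d F)
    (ht : 2 ≤ t) {L : Type} [Fintype L] (S : L → Finset (Fin m)) (hS : ∀ l, (S l).card ≤ d)
    (u : L → (Fin m → Fin t → ZMod 2) → ℝ) (v : L → (Fin m → Fin t) → ℝ)
    (hu0 : ∀ l x, 0 ≤ u l x) (hv0 : ∀ l w, 0 ≤ v l w)
    (hu : ∀ l (x x' : Fin m → Fin t → ZMod 2), (∀ i ∈ S l, x i = x' i) → u l x = u l x')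
    (a : (Fin m → Fin t → ZMod 2) → ℝ) (b : (Fin m → Fin t) → ℝ)
    (ha : ∀ x, 0 < a x) (hb : ∀ w, 0 < b w) :
    ¬ ∀ (x : Fin m → Fin t → ZMod 2) (w : Fin m → Fin t),
        (viol F (fun i => x i (w i)) : ℝ) = ∑ l, u l x * v l w + a x * b w :=
  no_rowJuntaTerms_anchor_of hE ht S hS (fun l x w => u l x * v l w)
    (fun l x w => mul_nonneg (hu0 l x) (hv0 l w)) (fun l w x x' h => by rw [hu l x x' h]) a b ha hb

/-! ## §4 Anchored cone factorisations with a junta side -/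

/-- **No anchored cone factorisation with junta COLUMNS.** In the anchored format of `AnchoredLifting`
(`viol_F(x[w]) = tr(H_x Y_w) + ∑_l U_{x,l} V_{l,w} + a(x) b(w)`, `H_x, Y_w ⪰ 0`, `U, V ≥ 0`, `a, b > 0`): if the PSD
column factor `Y_w` depends only on `w i`, `i ∈ S₀` (`#S₀ ≤ d`) and every LP column factor `V_{l,·}` only on
`w i`, `i ∈ S l` (`#(S l) ≤ d`), the identity is impossible — for every `q`, `r`, every `t ≥ 2`, with `H`, `U` and
the anchor arbitrary. -/
theorem no_colJunta_anchoredConeFact_of {m d t q r : ℕ} {F : Finset (Pool m)}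
    (hE : HasPerfectPseudoExp d F) (ht : 2 ≤ t)
    (H : (Fin m → Fin t → ZMod 2) → Matrix (Fin q) (Fin q) ℝ)
    (Y : (Fin m → Fin t) → Matrix (Fin q) (Fin q) ℝ)
    (U : (Fin m → Fin t → ZMod 2) → Fin r → ℝ) (V : Fin r → (Fin m → Fin t) → ℝ)
    (hH : ∀ x, (H x).PosSemidef) (hY : ∀ w, (Y w).PosSemidef)
    (hU : ∀ x l, 0 ≤ U x l) (hV : ∀ l w, 0 ≤ V l w)
    (S₀ : Finset (Fin m)) (hS₀ : S₀.card ≤ d)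
    (hYj : ∀ w w' : Fin m → Fin t, (∀ i ∈ S₀, w i = w' i) → Y w = Y w')
    (S : Fin r → Finset (Fin m)) (hS : ∀ l, (S l).card ≤ d)
    (hVj : ∀ l (w w' : Fin m → Fin t), (∀ i ∈ S l, w i = w' i) → V l w = V l w')
    (a : (Fin m → Fin t → ZMod 2) → ℝ) (b : (Fin m → Fin t) → ℝ)
    (ha : ∀ x, 0 < a x) (hb : ∀ w, 0 < b w) :
    ¬ ∀ (x : Fin m → Fin t → ZMod 2) (w : Fin m → Fin t),
        (viol F (fun i => x i (w i)) : ℝ) = (H x * Y w).trace + ∑ l, U x l * V l w + a x * b w := by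
  intro hfact
  -- one PSD term (index `none`) and `r` LP terms (indices `some l`)
  refine no_colJuntaTerms_anchor_of hE ht (L := Option (Fin r))
    (fun o => o.elim S₀ S) (fun o => ?_)
    (fun o x w => o.elim ((H x * Y w).trace) (fun l => U x l * V l w)) (fun o x w => ?_) (fun o => ?_)
    a b ha hb ?_
  · cases o with
    | none => exact hS₀
    | some l => exact hS l
  · cases o with
    | none => exact trace_mul_nonneg_of_posSemidef (hH x) (hY w)
    | some l => exact mul_nonneg (hU x l) (hV l w)
  · cases o with
    | none => exact fun x w w' h => by simp only [Option.elim, hYj w w' h]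
    | some l => exact fun x w w' h => by simp only [Option.elim, hVj l w w' h]
  · intro x w
    rw [hfact x w, Fintype.sum_option]
    simp only [Option.elim]

/-- **No anchored cone factorisation with junta ROWS.** Dually: if the PSD row factor `H_x` depends only on the
blocks `x i`, `i ∈ S₀` (`#S₀ ≤ d`) and every LP row factor `U_{·,l}` only on the blocks `x i`, `i ∈ S l`
(`#(S l) ≤ d`), the anchored identity `viol_F(x[w]) = tr(H_x Y_w) + ∑_l U_{x,l} V_{l,w} + a(x) b(w)` is impossible
— for every `q`, `r`, every `t ≥ 2`, with `Y`, `V` and the anchor arbitrary. -/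
theorem no_rowJunta_anchoredConeFact_of {m d t q r : ℕ} {F : Finset (Pool m)}
    (hE : HasPerfectPseudoExp d F) (ht : 2 ≤ t)
    (H : (Fin m → Fin t → ZMod 2) → Matrix (Fin q) (Fin q) ℝ)
    (Y : (Fin m → Fin t) → Matrix (Fin q) (Fin q) ℝ)
    (U : (Fin m → Fin t → ZMod 2) → Fin r → ℝ) (V : Fin r → (Fin m → Fin t) → ℝ)
    (hH : ∀ x, (H x).PosSemidef) (hY : ∀ w, (Y w).PosSemidef)
    (hU : ∀ x l, 0 ≤ U x l) (hV : ∀ l w, 0 ≤ V l w)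
    (S₀ : Finset (Fin m)) (hS₀ : S₀.card ≤ d)
    (hHj : ∀ x x' : Fin m → Fin t → ZMod 2, (∀ i ∈ S₀, x i = x' i) → H x = H x')
    (S : Fin r → Finset (Fin m)) (hS : ∀ l, (S l).card ≤ d)
    (hUj : ∀ l (x x' : Fin m → Fin t → ZMod 2), (∀ i ∈ S l, x i = x' i) → U x l = U x' l)
    (a : (Fin m → Fin t → ZMod 2) → ℝ) (b : (Fin m → Fin t) → ℝ)
    (ha : ∀ x, 0 < a x) (hb : ∀ w, 0 < b w) :
    ¬ ∀ (x : Fin m → Fin t → ZMod 2) (w : Fin m → Fin t),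
        (viol F (fun i => x i (w i)) : ℝ) = (H x * Y w).trace + ∑ l, U x l * V l w + a x * b w := by
  intro hfact
  refine no_rowJuntaTerms_anchor_of hE ht (L := Option (Fin r))
    (fun o => o.elim S₀ S) (fun o => ?_)
    (fun o x w => o.elim ((H x * Y w).trace) (fun l => U x l * V l w)) (fun o x w => ?_) (fun o => ?_)
    a b ha hb ?_
  · cases o with
    | none => exact hS₀
    | some l => exact hS l
  · cases o with
    | none => exact trace_mul_nonneg_of_posSemidef (hH x) (hY w)
    | some l => exact mul_nonneg (hU x l) (hV l w)
  · cases o with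
    | none => exact fun w x x' h => by simp only [Option.elim, hHj x x' h]
    | some l => exact fun w x x' h => by simp only [Option.elim, hUj l x x' h]
  · intro x w
    rw [hfact x w, Fintype.sum_option]
    simp only [Option.elim]

end

end Summit.PneNP.PneNP.Theorems.XorDoor
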